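import Summits.BirchSwinnertonDyer.Rank1Residual.X2.ClassClosureOfDerivedFacts
import Summits.BirchSwinnertonDyer.Rank1Residual.X2.GreenbergVatsalOfDerivedProp510
import Summits.BirchSwinnertonDyer.Rank1Residual.X11a.RankZeroHeightFree
import Literature.NumberTheory.EllipticCurves.GreenbergVatsal2000.CharacterPAdicLFunctionExistenceProofs
import HarnessLib

/-!
# Class X2 — the closure terms of record with F0 (Kubota–Leopoldt existence, A223) DISCHARGED by
# gen 23's theorem `exists_characterLFunction_holds`, and `X2.TargetA` HEIGHT-FREE (cell `b2b-bsdres`,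
# unit `b2b-bsdres-eisenstein-p2`, gen 24; corollary file of gens 21/22's `EisensteinCongruenceOfFacts`,
# `GreenbergProp510OfFacts`, `GreenbergVatsalOfDerivedProp510`, `ClassClosureOfDerivedFacts` and of
# x11a's `X11a/RankZeroHeightFree`)

HONEST FRAMING (run/shared/lean/b2b/bsd-rank1-residual/, verbatim in every file): the goal of the
cell is to DELETE the COMBINATION-SHAPED residual classes of the Birch–Swinnerton-Dyer formula for
ALL analytic-rank `≤ 1` elliptic curves over `ℚ` — "full BSD formula for every rank `≤ 1` curve in
class `C`" assembled STRICTLY from published theorems — so that the rank-`≤ 1` remainder becomes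
exactly the CONSTRUCTION-SHAPED classes, which are TYPED (missing-input `Prop`s), NOT attempted.
This is not "finishing BSD". Research route; NO CLAIM BEYOND STATED CLASSES; nothing here changes
a label (the seat proposes, the referee rules: X2a's tier of record is referee A's R199.2/R201.2;
X2b/X2c stay CONSTRUCTION-SHAPED). Theorems only: no definition, no new named fact; every published
input enters as one of the tree's existing named Literature facts BY NAME; the residues enter as
explicit per-pair hypotheses.

WHAT. After gen 23, the named fact F0 = A223
`GreenbergVatsal2000.exists_characterLFunction` (GV 2000 §3 pp. 41–42: the non-primitive
Kubota–Leopoldt `p`-adic `L`-functions `L_{Σ₀}(C,T)`, `L_{Σ₀}(D,T) ∈ Λ`) is a THEOREM of the tree: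
`GreenbergVatsal2000.exists_characterLFunction_holds` (Lang, *Cyclotomic Fields I–II*, Ch. 2 §2,
Ch. 4 §§1–3, formalised in `Literature/…/GreenbergVatsal2000/CharacterPAdicLFunctionExistenceProofs`
and its imports). Every closure term of the X2 lineage that took `hEx : exists_characterLFunction` is
re-issued here with that binder DISCHARGED (X2-GAP §28.5 (a)):

* A61 (Greenberg LNM 1716 Prop. 5.10): `prop510_isTorsion_hasUnitContent_of_gvPar_of_derivedF0 :
  A40 → A41 → F2 → F3 → A61`, and its Tate-free good-ordinary half `prop510_goodOrd_of_derivedF0`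
  (F2/F3 only);
* A196 / A212 (GV Thm. (3.11)+(28)+p. 43 transcribed at `p ‖ N` / at good ordinary `p`):
  `…_of_derivedF0 : A40 → A41 → F1 → F2 → F3 → A196`, `…_goodOrd_of_derivedF0 : F1 → F2 → F3 → A212`;
* A64 / A63 (`lambda_muAnal_multiplicative_of_gvPar`, `lambdaMu_multiplicative_of_gvPar`), Mazur's
  main conjecture at every odd multiplicative pair of GV parity, A14 (GV Thm. (1.3) at good ordinary
  `p`), the class theorem of record `target_of_derivedF0_of_residues` and its per-pair form — all
  `_of_derivedF0`;
* **`targetA_of_derivedF0_heightFree : X2.TargetA` from SEVENTEEN registered facts** — gen 22's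
  `targetA_of_derivedFacts` (20 binders) with `hEx` discharged by gen 23 and the two Stein–Wuthrich
  §4.2 height-existence facts (`exists_isSplitMultCanonical`, `exists_isMultCanonical`) discharged
  at analytic rank `0` by x11a gen 18's `X2.targetA_of_published_heightFree` (on a finite `E(ℚ)` THE
  §4.2 datum is the zero pairing). Registered inputs of the X2a closure term after gen 24:
  A40/A41 (Tate uniformisation), A133/A135/A137 (GV §§1–2 at `p ‖ N`), A195 (GV p. 28/30 lifting),
  A180 (GV Cor. (3.8)), F1 (GV Thm. (3.11)+(28)), F2/F3 (Ferrero–Washington + Mazur–Wiles character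
  identities), A33 (Wuthrich Thm. 16), Stein–Wuthrich Thm. 6.1 (split / non-split), GZK, modularity
  (`L(E,s)` entire; a modular parametrisation), Greenberg–Stevens.

Nothing is re-proved: every theorem below is a one-line application of the cited tree theorems to
`exists_characterLFunction_holds`.

References: [GreenbergVatsal2000] Thm. (1.3), §2 pp. 26–30, §3 Thm. (3.11), (26)–(28), pp. 41–43,
Cor. (3.8); [LangCyclotomic1990] Ch. 2 §2, Ch. 4 §§1–3 (Thm. 3.2); [GreenbergLNM1716] Prop. 5.10
(PDF pp. 147–148); [Wuthrich2014] Thm. 16; [SteinWuthrich2013] Thm. 6.1, §4.2; [Disegni2020] Thm. 4;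
HOME/b2b-bsdres-eisenstein-p2/X2-GAP.md §§27–29.
-/

set_option autoImplicit false

noncomputable section

open scoped Classical MatrixGroups ModularForm

open PowerSeries CongruenceSubgroup WeierstrassCurve Literature.NumberTheory.EllipticCurves
  Literature.NumberTheory.EllipticCurves.ModularForms
  Literature.NumberTheory.EllipticCurves.Rank1Residual
  Literature.NumberTheory.EllipticCurves.Rank1Residual.Typed
  Literature.NumberTheory.EllipticCurves.GreenbergVatsal2000
  Literature.NumberTheory.EllipticCurves.Greenberg1999
  Literature.NumberTheory.EllipticCurves.Wuthrich2014
  Literature.NumberTheory.EllipticCurves.SteinWuthrich2013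
  Literature.NumberTheory.EllipticCurves.Disegni2020
  Summit.BirchSwinnertonDyer.Rank1Residual.X2.GreenbergVatsalInputsOfFacts
  Summit.BirchSwinnertonDyer.Rank1Residual.X2.EisensteinCongruenceOfFacts
  Summit.BirchSwinnertonDyer.Rank1Residual.X2.GreenbergProp510OfFacts
  Summit.BirchSwinnertonDyer.Rank1Residual.X2.GreenbergVatsalOfUnfoldedFacts
  Summit.BirchSwinnertonDyer.Rank1Residual.X2.GreenbergVatsalOfDerivedProp510

namespace Summit.BirchSwinnertonDyer.Rank1Residual.X2.ClassClosureOfDerivedF0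

/-! ## §1. A61 (Greenberg Prop. 5.10) with F0 discharged -/

/-- **A61 = Greenberg LNM 1716 Prop. 5.10 from `A40 → A41 → F2 → F3`** — gen 22's
`prop510_isTorsion_hasUnitContent_of_gvPar_of_facts` with the Kubota–Leopoldt existence `hEx` (F0)
supplied by gen 23's theorem `exists_characterLFunction_holds`.
[cite: GreenbergLNM1716, Prop. 5.10 (PDF pp. 147–148)]
[cite: GreenbergVatsal2000, §3 pp. 41–42 (L_{Σ₀}(C,T), L_{Σ₀}(D,T))] -/
theorem prop510_isTorsion_hasUnitContent_of_gvPar_of_derivedF0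
    (hT : Silverman1994_thmV53_tateUniformisation.{0})
    (hT' : Silverman1994_thmV53_corV54_tateUniformisation.{0})
    (hC : characterLFunctionC_hasUnitContent_and_order_eq_card)
    (hD : characterLFunctionD_hasUnitContent_and_order_eq_card) :
    prop510_isTorsion_hasUnitContent_of_gvPar :=
  prop510_isTorsion_hasUnitContent_of_gvPar_of_facts hT hT' exists_characterLFunction_holds hC hD

/-- **The good-ordinary half of Prop. 5.10 from F2/F3 alone** (no Tate fact, no F0 binder): for
`E/ℚ` globally minimal, `p` odd good ordinary, `GVPar W p`, `κ` cyclotomic with topological generator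
`γ`, every dual datum `D` of `Sel_{p^∞}(E/ℚ_∞)` is `Λ`-torsion with a unit-content generator of its
characteristic ideal. [cite: GreenbergLNM1716, Prop. 5.10 (PDF pp. 147–148)] -/
theorem prop510_goodOrd_of_derivedF0
    (hC : characterLFunctionC_hasUnitContent_and_order_eq_card)
    (hD : characterLFunctionD_hasUnitContent_and_order_eq_card)
    (W : WeierstrassCurve ℚ) [W.IsGloballyMinimal] [W.IsElliptic] (p : ℕ) [Fact p.Prime]
    (κ : ZpExtension ℚ p) (hp2 : p ≠ 2) (hgood : W.HasGoodReductionAtPrime p)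
    (hord : ¬ (p : ℤ) ∣ W.frobeniusTrace p) (hpar : GVPar W p) {γ : Field.absoluteGaloisGroup ℚ}
    (hκ : κ.IsCyclotomic) (hγ : κ.IsTopGenerator γ) (D : W.SelmerDualData κ γ) :
    D.IsTorsion ∧ ∃ g : IwasawaAlgebra p, D.charIdeal = Ideal.span {g} ∧ HasUnitContent g :=
  prop510_goodOrd_of_facts W p κ exists_characterLFunction_holds hC hD hp2 hgood hord hpar hκ hγ D

/-! ## §2. A196 / A212 (GV Thm. (3.11)+(28)+p. 43 transcribed) with F0 discharged -/

/-- **A196 = `nonPrimitive_unitContent_and_lambda_eq_residual_of_lineRamifiedEven` (GV Thm. (3.11)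
+ (28) + p. 43 at a multiplicative prime) from `A40 → A41 → F1 → F2 → F3`** — gen 21's `…_of_facts`
with `hEx` supplied by `exists_characterLFunction_holds`.
[cite: GreenbergVatsal2000, §3 Thm. (3.11), (28) and p. 43, with pp. 41–42] -/
theorem nonPrimitive_unitContent_and_lambda_eq_residual_of_lineRamifiedEven_of_derivedF0
    (hT : Silverman1994_thmV53_tateUniformisation.{0})
    (hT' : Silverman1994_thmV53_corV54_tateUniformisation.{0})
    (h311 : thm311_hasUnitContent_iff_and_order_eq_of_lineRamifiedEven)
    (hC : characterLFunctionC_hasUnitContent_and_order_eq_card)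
    (hD : characterLFunctionD_hasUnitContent_and_order_eq_card) :
    nonPrimitive_unitContent_and_lambda_eq_residual_of_lineRamifiedEven :=
  nonPrimitive_unitContent_and_lambda_eq_residual_of_lineRamifiedEven_of_facts hT hT'
    exists_characterLFunction_holds h311 hC hD

/-- **A212 (= p253710) = the good-ordinary twin `…_lineRamifiedEven_goodOrd` from `F1 → F2 → F3`**
(no Tate fact, no F0 binder) — gen 21's `…_goodOrd_of_facts` with `hEx` supplied by
`exists_characterLFunction_holds`. [cite: GreenbergVatsal2000, §3 Thm. (3.11), (28) and p. 43, with pp. 41–42] -/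
theorem nonPrimitive_unitContent_and_lambda_eq_residual_of_lineRamifiedEven_goodOrd_of_derivedF0
    (h311 : thm311_hasUnitContent_iff_and_order_eq_of_lineRamifiedEven)
    (hC : characterLFunctionC_hasUnitContent_and_order_eq_card)
    (hD : characterLFunctionD_hasUnitContent_and_order_eq_card) :
    nonPrimitive_unitContent_and_lambda_eq_residual_of_lineRamifiedEven_goodOrd :=
  nonPrimitive_unitContent_and_lambda_eq_residual_of_lineRamifiedEven_goodOrd_of_facts
    exists_characterLFunction_holds h311 hC hD

/-! ## §3. A64 / A63 / Mazur's main conjecture at GV parity with F0 discharged -/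

/-- **A64 = `GreenbergVatsal2000.lambda_muAnal_multiplicative_of_gvPar` from registered facts with
F0 discharged**: A40/A41, A133/A135/A137, A195, A180, F1/F2/F3 (ten binders).
[cite: GreenbergVatsal2000, Thm. (1.3), §2 (16), pp. 28–30, §3 Thm. (3.11), (28), pp. 41–43, Cor. (3.8)] -/
theorem lambda_muAnal_multiplicative_of_gvPar_of_derivedF0
    (hT : Silverman1994_thmV53_tateUniformisation.{0})
    (hT' : Silverman1994_thmV53_corV54_tateUniformisation.{0})
    (hA : lambda_nonPrimitive_eq_add_sum_delta_multiplicative)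
    (hB : datumSelmer_divisible_of_finite_torsionBy)
    (hF : datumStrictSelmer_lt_datumSelmer_of_split)
    (hLiftF : residualEpsilon_surjOn_of_lineRamifiedEven)
    (hP : cor38_realPeriodRat_eq_unit_mul_of_isIsogenous_of_gvPar)
    (h311 : thm311_hasUnitContent_iff_and_order_eq_of_lineRamifiedEven)
    (hC : characterLFunctionC_hasUnitContent_and_order_eq_card)
    (hD : characterLFunctionD_hasUnitContent_and_order_eq_card) :
    lambda_muAnal_multiplicative_of_gvPar :=
  lambda_muAnal_multiplicative_of_gvPar_of_derivedFacts hT hT' hA hB hF hLiftF hP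
    exists_characterLFunction_holds h311 hC hD

/-- **A63 = `GreenbergVatsal2000.lambdaMu_multiplicative_of_gvPar` from registered facts with F0
discharged** (+ Wuthrich 2014 Thm. 16, `hWu`).
[cite: GreenbergVatsal2000, Thm. (1.3), §2 (16), pp. 28–30, §3 Thm. (3.11), (28), pp. 41–43, Cor. (3.8)]
[cite: Wuthrich2014, Thm. 16 (p. 397)] -/
theorem lambdaMu_multiplicative_of_gvPar_of_derivedF0
    (hT : Silverman1994_thmV53_tateUniformisation.{0})
    (hT' : Silverman1994_thmV53_corV54_tateUniformisation.{0})
    (hA : lambda_nonPrimitive_eq_add_sum_delta_multiplicative)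
    (hB : datumSelmer_divisible_of_finite_torsionBy)
    (hF : datumStrictSelmer_lt_datumSelmer_of_split)
    (hLiftF : residualEpsilon_surjOn_of_lineRamifiedEven)
    (hP : cor38_realPeriodRat_eq_unit_mul_of_isIsogenous_of_gvPar)
    (h311 : thm311_hasUnitContent_iff_and_order_eq_of_lineRamifiedEven)
    (hC : characterLFunctionC_hasUnitContent_and_order_eq_card)
    (hD : characterLFunctionD_hasUnitContent_and_order_eq_card)
    (hWu : thm16_charIdeal_dvd_multiplicative_of_reducible) :
    lambdaMu_multiplicative_of_gvPar :=
  lambdaMu_multiplicative_of_gvPar_of_derivedFacts hT hT' hA hB hF hLiftF hP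
    exists_characterLFunction_holds h311 hC hD hWu

/-- **Mazur's main conjecture at every odd multiplicative pair of GV parity, from registered facts
with F0 discharged** (gen 22's `mazurMainConjectureAt_of_gvPar_of_derivedFacts`, `hEx` supplied).
[cite: GreenbergVatsal2000, Thm. (1.3) with §2 pp. 28–30, §3 Thm. (3.11), (28), pp. 41–43, Cor. (3.8)]
[cite: Wuthrich2014, Thm. 16 (p. 397)] -/
theorem mazurMainConjectureAt_of_gvPar_of_derivedF0
    (hT : Silverman1994_thmV53_tateUniformisation.{0})
    (hT' : Silverman1994_thmV53_corV54_tateUniformisation.{0})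
    (hA : lambda_nonPrimitive_eq_add_sum_delta_multiplicative)
    (hB : datumSelmer_divisible_of_finite_torsionBy)
    (hF : datumStrictSelmer_lt_datumSelmer_of_split)
    (hLiftF : residualEpsilon_surjOn_of_lineRamifiedEven)
    (hP : cor38_realPeriodRat_eq_unit_mul_of_isIsogenous_of_gvPar)
    (h311 : thm311_hasUnitContent_iff_and_order_eq_of_lineRamifiedEven)
    (hC : characterLFunctionC_hasUnitContent_and_order_eq_card)
    (hD : characterLFunctionD_hasUnitContent_and_order_eq_card)
    (hWu : thm16_charIdeal_dvd_multiplicative_of_reducible)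
    (W : WeierstrassCurve ℚ) [W.IsElliptic] [W.IsGloballyMinimal] (p : ℕ) [Fact p.Prime]
    (hp : p ≠ 2) (hmult : W.HasMultiplicativeReductionAtPrime p) (hgv : GVPar W p) :
    MazurMainConjectureAt W p :=
  mazurMainConjectureAt_of_gvPar_of_derivedFacts hT hT' hA hB hF hLiftF hP
    exists_characterLFunction_holds h311 hC hD hWu W p hp hmult hgv

/-! ## §4. `X2.TargetA` — seventeen registered facts -/

/-- **`X2.TargetA` (the X2a closure of record: `BSD(E,p)` at every X2a pair — `r_an = 0`, `p` odd
multiplicative Eisenstein of GV parity) from SEVENTEEN registered facts**: gen 22's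
`targetA_of_derivedFacts` with `hEx` (F0) discharged by gen 23's `exists_characterLFunction_holds` and
the two §4.2 height-existence facts (`hHs`, `hHn`) discharged at analytic rank `0` by x11a's
`X2.targetA_of_published_heightFree` (on a finite `E(ℚ)` no point is admissible, so THE §4.2 datum is
the zero pairing). Registered inputs: `hT`/`hT'` A40/A41 · `hA` A133 · `hB` A135 · `hF` A137 ·
`hLiftF` A195 · `hP` A180 · `h311` F1 · `hC`/`hD` F2/F3 · `hWu` A33 · `hJs`/`hJn` Stein–Wuthrich
Thm. 6.1 · `hGZK` · `hmod` · `hpar` · `hGS` Greenberg–Stevens.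
[cite: GreenbergVatsal2000, Thm. (1.3) with pp. 1, 14–15, §3 Thm. (3.11), pp. 41–43]
[cite: Wuthrich2014, Thm. 16 (p. 397)] [cite: SteinWuthrich2013, Thm. 6.1 (p. 20), §4.2] -/
theorem targetA_of_derivedF0_heightFree
    (hT : Silverman1994_thmV53_tateUniformisation.{0})
    (hT' : Silverman1994_thmV53_corV54_tateUniformisation.{0})
    (hA : lambda_nonPrimitive_eq_add_sum_delta_multiplicative)
    (hB : datumSelmer_divisible_of_finite_torsionBy)
    (hF : datumStrictSelmer_lt_datumSelmer_of_split)
    (hLiftF : residualEpsilon_surjOn_of_lineRamifiedEven)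
    (hP : cor38_realPeriodRat_eq_unit_mul_of_isIsogenous_of_gvPar)
    (h311 : thm311_hasUnitContent_iff_and_order_eq_of_lineRamifiedEven)
    (hC : characterLFunctionC_hasUnitContent_and_order_eq_card)
    (hD : characterLFunctionD_hasUnitContent_and_order_eq_card)
    (hWu : thm16_charIdeal_dvd_multiplicative_of_reducible)
    (hJs : thm61_splitMultiplicative) (hJn : thm61_nonsplitMultiplicative)
    (hGZK : rank_eq_analyticRank_of_analyticRank_le_one) (hmod : hasEntireLFunction_rat)
    (hpar : nonempty_modularParametrizationData)
    (hGS : ∀ (W : WeierstrassCurve ℚ) [W.IsElliptic] [W.IsGloballyMinimal] (p : ℕ) [Fact p.Prime],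
      greenberg_stevens (W := W) (p := p)) :
    TargetA :=
  X2.targetA_of_published_heightFree
    (lambdaMu_multiplicative_of_gvPar_of_derivedF0 hT hT' hA hB hF hLiftF hP h311 hC hD hWu)
    hWu hJs hJn hGZK hmod hpar hGS

/-- **`X2.TargetA` in gen 22's binder shape with only `hEx` discharged** (nineteen binders; kept for
consumers that still carry the height facts). [cite: GreenbergVatsal2000, Thm. (1.3) with pp. 1, 14–15, §3 Thm. (3.11)]
[cite: Wuthrich2014, Thm. 16 (p. 397)] [cite: SteinWuthrich2013, Thm. 6.1 (p. 20)] -/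
theorem targetA_of_derivedF0
    (hT : Silverman1994_thmV53_tateUniformisation.{0})
    (hT' : Silverman1994_thmV53_corV54_tateUniformisation.{0})
    (hA : lambda_nonPrimitive_eq_add_sum_delta_multiplicative)
    (hB : datumSelmer_divisible_of_finite_torsionBy)
    (hF : datumStrictSelmer_lt_datumSelmer_of_split)
    (hLiftF : residualEpsilon_surjOn_of_lineRamifiedEven)
    (hP : cor38_realPeriodRat_eq_unit_mul_of_isIsogenous_of_gvPar)
    (h311 : thm311_hasUnitContent_iff_and_order_eq_of_lineRamifiedEven)
    (hC : characterLFunctionC_hasUnitContent_and_order_eq_card)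
    (hD : characterLFunctionD_hasUnitContent_and_order_eq_card)
    (hWu : thm16_charIdeal_dvd_multiplicative_of_reducible)
    (hJs : thm61_splitMultiplicative) (hJn : thm61_nonsplitMultiplicative)
    (hHs : exists_isSplitMultCanonical) (hHn : exists_isMultCanonical)
    (hGZK : rank_eq_analyticRank_of_analyticRank_le_one) (hmod : hasEntireLFunction_rat)
    (hpar : nonempty_modularParametrizationData)
    (hGS : ∀ (W : WeierstrassCurve ℚ) [W.IsElliptic] [W.IsGloballyMinimal] (p : ℕ) [Fact p.Prime],
      greenberg_stevens (W := W) (p := p)) :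
    TargetA :=
  targetA_of_derivedFacts hT hT' hA hB hF hLiftF hP exists_characterLFunction_holds h311 hC hD hWu hJs
    hJn hHs hHn hGZK hmod hpar hGS

/-! ## §5. A14 (GV Thm. (1.3), printed good-ordinary setting) with F0 discharged -/

/-- **A14 = `GreenbergVatsal2000.thm13_charIdeal_eq_of_gvPar` from registered facts with F0
discharged** (gen 22's `thm13_charIdeal_eq_of_gvPar_of_derivedFacts`, `hEx` supplied). The Tate facts
`hT`/`hT'` enter only through A61 being ONE statement for both reduction types (the good-ordinary
half of Prop. 5.10 is Tate-free: `prop510_goodOrd_of_derivedF0`).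
[cite: GreenbergVatsal2000, Thm. (1.3), §2 (16), pp. 26–30, §3 Thm. (3.11), (28), pp. 41–43, Cor. (3.8)]
[cite: Wuthrich2014, Thm. 16 (p. 393)] -/
theorem thm13_charIdeal_eq_of_gvPar_of_derivedF0
    (hT : Silverman1994_thmV53_tateUniformisation.{0})
    (hT' : Silverman1994_thmV53_corV54_tateUniformisation.{0})
    (hGV : imKummer_ge_greenbergCondition_at_p) (hA : lambda_nonPrimitive_eq_add_sum_delta)
    (hB : divisible_nonPrimitiveSelmerInfty_of_mu_eq_zero)
    (hLiftF : residualEpsilon_surjOn_of_lineRamifiedEven)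
    (hP : cor38_realPeriodRat_eq_unit_mul_of_isIsogenous_of_gvPar)
    (hW16 : Wuthrich2014.charIdeal_dvd_padicLFunction)
    (h311 : thm311_hasUnitContent_iff_and_order_eq_of_lineRamifiedEven)
    (hC : characterLFunctionC_hasUnitContent_and_order_eq_card)
    (hD : characterLFunctionD_hasUnitContent_and_order_eq_card) :
    thm13_charIdeal_eq_of_gvPar :=
  thm13_charIdeal_eq_of_gvPar_of_derivedFacts hT hT' hGV hA hB hLiftF hP hW16
    exists_characterLFunction_holds h311 hC hD

/-! ## §6. The class theorem of record and its per-pair form with F0 discharged -/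

/-- **THE CLASS THEOREM OF RECORD MODULO NAMED RESIDUES, F0 discharged** — gen 22's
`target_of_derivedFacts_of_residues` with `hEx` supplied by `exists_characterLFunction_holds`.
Registered inputs: A40/A41, A133/A135/A137, A195, A180, F1/F2/F3, A33, + the rank-`≤ 1` assembly
facts (the §4.2 height facts stay: they are load-bearing for the rank-ONE residues); per-pair
residues exactly as in gen 19 (`hResB`, `hResCns`, `hResCs`).
[cite: GreenbergVatsal2000, Thm. (1.3), §2 pp. 26–30, §3 Thm. (3.11), (26)–(28), pp. 41–43, Cor. (3.8)]
[cite: Wuthrich2014, Thm. 16 (p. 397)] [cite: Disegni2020, Thm. 4 (§3.2)]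
[cite: SteinWuthrich2013, Thm. 6.1 (p. 20)] -/
theorem target_of_derivedF0_of_residues
    (hT : Silverman1994_thmV53_tateUniformisation.{0})
    (hT' : Silverman1994_thmV53_corV54_tateUniformisation.{0})
    (hA : lambda_nonPrimitive_eq_add_sum_delta_multiplicative)
    (hB : datumSelmer_divisible_of_finite_torsionBy)
    (hF : datumStrictSelmer_lt_datumSelmer_of_split)
    (hLiftF : residualEpsilon_surjOn_of_lineRamifiedEven)
    (hP : cor38_realPeriodRat_eq_unit_mul_of_isIsogenous_of_gvPar)
    (h311 : thm311_hasUnitContent_iff_and_order_eq_of_lineRamifiedEven)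
    (hC : characterLFunctionC_hasUnitContent_and_order_eq_card)
    (hD : characterLFunctionD_hasUnitContent_and_order_eq_card)
    (hWu : thm16_charIdeal_dvd_multiplicative_of_reducible)
    (hJs : thm61_splitMultiplicative) (hJn : thm61_nonsplitMultiplicative)
    (hHs : exists_isSplitMultCanonical) (hHn : exists_isMultCanonical)
    (hGZ : GrossZagier1986_thm_I_7_3) (hGZK : rank_eq_analyticRank_of_analyticRank_le_one)
    (hmod : hasEntireLFunction_rat) (hpar : nonempty_modularParametrizationData)
    (hGS : ∀ (W : WeierstrassCurve ℚ) [W.IsElliptic] [W.IsGloballyMinimal] (p : ℕ) [Fact p.Prime],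
      greenberg_stevens (W := W) (p := p))
    (hDis : padicBSD_rankOne_nonsplitMult)
    (hResB : ∀ (W : WeierstrassCurve ℚ) [W.IsElliptic] [W.IsGloballyMinimal] (p : ℕ) [Fact p.Prime],
      CellB W p → MazurMainConjectureAt W p)
    (hResCns : ∀ (W : WeierstrassCurve ℚ) [W.IsElliptic] [W.IsGloballyMinimal] (p : ℕ) [Fact p.Prime],
      CellC W p → ¬ W.HasSplitMultiplicativeReductionAtPrime p →
        (GVPar W p ∨ MazurMainConjectureAt W p) ∧
        ∀ (q : ℚ_[p]) (Dh : PAdicHeightData W p), q ≠ 0 → ‖q‖ < 1 → tateJ q = (W.j : ℚ_[p]) →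
          IsMultCanonical Dh q → SchneiderConjecture Dh)
    (hResCs : ∀ (W : WeierstrassCurve ℚ) [W.IsElliptic] [W.IsGloballyMinimal] (p : ℕ) [Fact p.Prime],
      CellC W p → W.HasSplitMultiplicativeReductionAtPrime p →
        (GVPar W p ∨ MazurMainConjectureAt W p) ∧ O9.ExceptionalLeadingTermAt W p ∧
        ∀ (Dq : TateParameterData W p) (Dh : PAdicHeightData W p),
          IsSplitMultCanonical Dh Dq → SchneiderConjecture Dh) :
    Target :=
  target_of_derivedFacts_of_residues hT hT' hA hB hF hLiftF hP exists_characterLFunction_holds h311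
    hC hD hWu hJs hJn hHs hHn hGZ hGZK hmod hpar hGS hDis hResB hResCns hResCs

/-- **X2 per pair at GV parity: `BSD(E,p)` with F0 discharged** — gen 22's
`bsdp_of_classX2_of_gvPar_of_derivedFacts`, `hEx` supplied; residues only at rank one (non-split:
Schneider certificate; split: `O9.ExceptionalLeadingTermAt` ∧ Schneider).
[cite: GreenbergVatsal2000, Thm. (1.3) with §2 pp. 28–30, §3 Thm. (3.11), pp. 41–43, Cor. (3.8)]
[cite: Disegni2020, Thm. 4 (§3.2)] [cite: Wuthrich2014, Thm. 16 (p. 397)] -/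
theorem bsdp_of_classX2_of_gvPar_of_derivedF0
    (hT : Silverman1994_thmV53_tateUniformisation.{0})
    (hT' : Silverman1994_thmV53_corV54_tateUniformisation.{0})
    (hA : lambda_nonPrimitive_eq_add_sum_delta_multiplicative)
    (hB : datumSelmer_divisible_of_finite_torsionBy)
    (hF : datumStrictSelmer_lt_datumSelmer_of_split)
    (hLiftF : residualEpsilon_surjOn_of_lineRamifiedEven)
    (hP : cor38_realPeriodRat_eq_unit_mul_of_isIsogenous_of_gvPar)
    (h311 : thm311_hasUnitContent_iff_and_order_eq_of_lineRamifiedEven)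
    (hC : characterLFunctionC_hasUnitContent_and_order_eq_card)
    (hD : characterLFunctionD_hasUnitContent_and_order_eq_card)
    (hWu : thm16_charIdeal_dvd_multiplicative_of_reducible)
    (hJs : thm61_splitMultiplicative) (hJn : thm61_nonsplitMultiplicative)
    (hHs : exists_isSplitMultCanonical) (hHn : exists_isMultCanonical)
    (hGZ : GrossZagier1986_thm_I_7_3) (hGZK : rank_eq_analyticRank_of_analyticRank_le_one)
    (hmod : hasEntireLFunction_rat) (hpar : nonempty_modularParametrizationData)
    (W : WeierstrassCurve ℚ) [W.IsElliptic] [W.IsGloballyMinimal] (p : ℕ) [Fact p.Prime]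
    (hGS : greenberg_stevens (W := W) (p := p)) (hDis : padicBSD_rankOne_nonsplitMult)
    (hr : W.analyticRank ≤ 1) (hX : ClassX2 W p) (hgv : GVPar W p)
    (hSchNs : W.analyticRank = 1 → ¬ W.HasSplitMultiplicativeReductionAtPrime p →
      ∀ (q : ℚ_[p]) (Dh : PAdicHeightData W p), q ≠ 0 → ‖q‖ < 1 → tateJ q = (W.j : ℚ_[p]) →
        IsMultCanonical Dh q → SchneiderConjecture Dh)
    (hExcS : W.analyticRank = 1 → W.HasSplitMultiplicativeReductionAtPrime p →
      O9.ExceptionalLeadingTermAt W p ∧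
      ∀ (Dq : TateParameterData W p) (Dh : PAdicHeightData W p),
        IsSplitMultCanonical Dh Dq → SchneiderConjecture Dh) :
    BSDp W p :=
  bsdp_of_classX2_of_gvPar_of_derivedFacts hT hT' hA hB hF hLiftF hP exists_characterLFunction_holds
    h311 hC hD hWu hJs hJn hHs hHn hGZ hGZK hmod hpar W p hGS hDis hr hX hgv hSchNs hExcS

end Summit.BirchSwinnertonDyer.Rank1Residual.X2.ClassClosureOfDerivedF0

end
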